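import Summits.FinalStateConjecture.FinalStateConjecture.Theorems.PhotonSphereChannelsParametricPrimitive

/-!
# Route PhotonSphereChannels — the Duhamel operator at finite regularity: `F ∈ C¹ ⇒ D F ∈ C²` (well-posedness, II)

The Duhamel operator `D F (t, x) = ½ ∫ s in 0..t, (Φ (s, x+(t−s)) − Φ (s, x−(t−s)))`,
`Φ (s, ·)` the primitive of `F (s, ·)` (i.e. `½ ∫₀ᵗ ∫_{x−(t−s)}^{x+(t−s)} F`, ORIENTED integrals,
all real `t`), for `F` of finite regularity — the form in which the Picard iteration for the Cauchy
problem of `ψ_tt − ψ_xx + Vψ = 0` uses it (stub `stub_rwCauchy` of crux stmt-FinalStateConjecture-10045;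
`BlindnessInsidePhotonSphere`, stmt-…-10049):

* `contDiff_duhamel_nat` — `F ∈ C^n ⇒ D F ∈ C^n`; `fderiv_duhamel'` — for `F ∈ C¹` the first
  partials are the characteristic integrals
  `∂D(t,x)(v) = ½ ∫₀ᵗ (F(s,x+(t−s))(v₁+v₂) + F(s,x−(t−s))(v₁−v₂)) ds`;
* **the gain of one derivative** `contDiff_two_duhamel` — `F ∈ C¹ ⇒ D F ∈ C²`, because
  `∂D = ½((A₊+A₋)•fst + (A₊−A₋)•snd)` with the `C¹` one-sided integrals
  `A± = ∫₀ᵗ F(s, x ± (t−s)) ds` (`contDiff_duhamel_side_nat`, `fderiv_duhamel_side'`);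
* `fderiv_fderiv_duhamel'` — all second partials `∂²D(z)(v)(w) = v₁w₁ F(z) + ½((v₁+v₂)(w₁+w₂) I₊ +
  (v₂−v₁)(w₁−w₂) I₋)`, `I± = ∫₀ᵗ ∂₂F(s, x ± (t−s)) ds`; hence `duhamel_wave_eq'` — `D_tt − D_xx = F`
  —, with zero Cauchy data (`duhamel_zero` of the smooth file, `fderiv_duhamel_zero'`).

No new definitions. (Evans, PDE, §2.4.2.) [folklore]
-/

namespace Summit.FinalStateConjecture.FinalStateConjecture.Theorems

open MeasureTheory Set Filter Topology intervalIntegral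
open scoped ContDiff

noncomputable section

namespace WaveEnergy

/-! ### The Duhamel operator at finite regularity (`F ∈ C¹ ⇒ D F ∈ C²`) -/

section DuhamelFinite

variable {F Φ D : ℝ × ℝ → ℝ}

/-- The parametric primitive `Φ (s, z) = ∫ y in 0..z, F (s, y)` of a `C^n` function is `C^n`. -/
theorem contDiff_primitive_snd_nat (n : ℕ) (hF : ContDiff ℝ n F)
    (hΦ : ∀ s z, Φ (s, z) = ∫ y in (0 : ℝ)..z, F (s, y)) : ContDiff ℝ n Φ := by
  have h1 := contDiff_parametric_primitive_nat (Q := ℝ) n (h := fun q : ℝ × ℝ => F (q.2, q.1))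
    (hF.comp (contDiff_snd.prodMk contDiff_fst))
  have heq : Φ = (fun q : ℝ × ℝ => ∫ s in (0 : ℝ)..q.1, F (q.2, s)) ∘ fun q : ℝ × ℝ => (q.2, q.1) := by
    funext q
    simp [hΦ q.1 q.2]
  rw [heq]
  exact h1.comp (contDiff_snd.prodMk contDiff_fst)

/-- `z ↦ Φ (s, z)` has derivative `F (s, z)` for continuous `F` (FTC). -/
theorem hasDerivAt_primitive_snd' (hF : Continuous F)
    (hΦ : ∀ s z, Φ (s, z) = ∫ y in (0 : ℝ)..z, F (s, y)) (s z : ℝ) :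
    HasDerivAt (fun ζ => Φ (s, ζ)) (F (s, z)) z := by
  have hc : Continuous fun y => F (s, y) := hF.comp (Continuous.prodMk_right s)
  have hfun : (fun ζ => Φ (s, ζ)) = fun ζ => ∫ y in (0 : ℝ)..ζ, F (s, y) := funext fun ζ => hΦ s ζ
  rw [hfun]
  exact intervalIntegral.integral_hasDerivAt_right (hc.intervalIntegrable _ _)
    hc.aestronglyMeasurable.stronglyMeasurableAtFilter hc.continuousAt

/-- Chain rule along `p ↦ (s, p.2 + c (p.1 − s))` for the primitive: derivative
`F (s, ·) • (snd + c fst)`. -/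
theorem hasFDerivAt_primitive_comp_affine' (hF : Continuous F)
    (hΦ : ∀ s z, Φ (s, z) = ∫ y in (0 : ℝ)..z, F (s, y)) (s c : ℝ) (p : ℝ × ℝ) :
    HasFDerivAt (fun q : ℝ × ℝ => Φ (s, q.2 + c * (q.1 - s)))
      (F (s, p.2 + c * (p.1 - s)) • (ContinuousLinearMap.snd ℝ ℝ ℝ + c • ContinuousLinearMap.fst ℝ ℝ ℝ))
      p := by
  have hg : HasFDerivAt (fun q : ℝ × ℝ => q.2 + c * (q.1 - s))
      (ContinuousLinearMap.snd ℝ ℝ ℝ + c • ContinuousLinearMap.fst ℝ ℝ ℝ) p := by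
    have h := ((ContinuousLinearMap.snd ℝ ℝ ℝ + c • ContinuousLinearMap.fst ℝ ℝ ℝ).hasFDerivAt
      (x := p)).sub_const (c * s)
    refine h.congr_of_eventuallyEq (Eventually.of_forall fun q => ?_)
    simp only [add_apply, ContinuousLinearMap.coe_snd', smul_apply, ContinuousLinearMap.coe_fst',
      smul_eq_mul]
    ring
  exact (hasDerivAt_primitive_snd' hF hΦ s (p.2 + c * (p.1 - s))).comp_hasFDerivAt p hg

/-- The Duhamel operator of a `C^n` function is `C^n` (no derivative gain claimed here). -/
theorem contDiff_duhamel_nat (n : ℕ) (hF : ContDiff ℝ n F)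
    (hΦ : ∀ s z, Φ (s, z) = ∫ y in (0 : ℝ)..z, F (s, y))
    (hD : ∀ t x, D (t, x) = (1 / 2) * ∫ s in (0 : ℝ)..t, (Φ (s, x + (t - s)) - Φ (s, x - (t - s)))) :
    ContDiff ℝ n D := by
  have hΦs := contDiff_primitive_snd_nat n hF hΦ
  have hJ : ContDiff ℝ n fun r : ℝ × (ℝ × ℝ) =>
      Φ (r.1, r.2.2 + (r.2.1 - r.1)) - Φ (r.1, r.2.2 - (r.2.1 - r.1)) := by
    refine (hΦs.comp ?_).sub (hΦs.comp ?_) <;> fun_prop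
  have hK := contDiff_leibniz_nat n hJ
  have heq : D = fun p : ℝ × ℝ => (1 / 2 : ℝ) * ∫ s in (0 : ℝ)..p.1,
      (fun r : ℝ × (ℝ × ℝ) => Φ (r.1, r.2.2 + (r.2.1 - r.1)) - Φ (r.1, r.2.2 - (r.2.1 - r.1))) (s, p) := by
    funext p
    rw [show p = (p.1, p.2) from rfl, hD]
  rw [heq]
  exact contDiff_const.mul hK

/-- **First derivatives of the Duhamel operator** (`F ∈ C¹`):
`∂D(t,x)(v) = ½ ∫ s in 0..t, (F (s, x+(t−s)) (v₁ + v₂) + F (s, x−(t−s)) (v₁ − v₂))`. [folklore] -/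
theorem fderiv_duhamel' (hF : ContDiff ℝ 1 F) (hΦ : ∀ s z, Φ (s, z) = ∫ y in (0 : ℝ)..z, F (s, y))
    (hD : ∀ t x, D (t, x) = (1 / 2) * ∫ s in (0 : ℝ)..t, (Φ (s, x + (t - s)) - Φ (s, x - (t - s))))
    (t x : ℝ) (v : ℝ × ℝ) :
    fderiv ℝ D (t, x) v = (1 / 2) * ∫ s in (0 : ℝ)..t,
      (F (s, x + (t - s)) * (v.1 + v.2) + F (s, x - (t - s)) * (v.1 - v.2)) := by
  have hΦs := contDiff_primitive_snd_nat 1 hF hΦ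
  set J : ℝ × (ℝ × ℝ) → ℝ := fun r =>
    Φ (r.1, r.2.2 + (r.2.1 - r.1)) - Φ (r.1, r.2.2 - (r.2.1 - r.1)) with hJdef
  have hJ : ContDiff ℝ 1 J := by
    refine (hΦs.comp ?_).sub (hΦs.comp ?_) <;> fun_prop
  have hK := contDiff_leibniz_nat 1 hJ
  have heq : D = fun p : ℝ × ℝ => (1 / 2 : ℝ) * ∫ s in (0 : ℝ)..p.1, J (s, p) := by
    funext p
    rw [show p = (p.1, p.2) from rfl, hD]
  rw [heq, fderiv_const_mul ((hK.differentiable (by simp)) (t, x))]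
  simp only [smul_apply, smul_eq_mul]
  rw [fderiv_leibniz_of_contDiff_one hJ (t, x) v]
  have hJ0 : J (t, (t, x)) = 0 := by simp [hJdef]
  rw [show ((t, x) : ℝ × ℝ).1 = t from rfl, hJ0, mul_zero, zero_add]
  congr 1
  refine intervalIntegral.integral_congr fun s _ => ?_
  have hslice : fderiv ℝ J (s, (t, x)) ((0 : ℝ), v) = fderiv ℝ (fun p : ℝ × ℝ => J (s, p)) (t, x) v := by
    rw [(hasFDerivAt_slice_snd' (hJ.differentiable (by simp)) s (t, x)).fderiv]
    rfl
  rw [hslice]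
  have hp := (hasFDerivAt_primitive_comp_affine' hF.continuous hΦ s 1 (t, x)).sub
    (hasFDerivAt_primitive_comp_affine' hF.continuous hΦ s (-1) (t, x))
  have hfun : (fun p : ℝ × ℝ => J (s, p))
      = fun q : ℝ × ℝ => Φ (s, q.2 + 1 * (q.1 - s)) - Φ (s, q.2 + -1 * (q.1 - s)) := by
    funext q
    simp only [hJdef, one_mul, neg_one_mul]
    ring_nf
  have hp' : HasFDerivAt (fun p : ℝ × ℝ => J (s, p))
      (F (s, (t, x).2 + 1 * ((t, x).1 - s))
          • (ContinuousLinearMap.snd ℝ ℝ ℝ + (1 : ℝ) • ContinuousLinearMap.fst ℝ ℝ ℝ)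
        - F (s, (t, x).2 + -1 * ((t, x).1 - s))
          • (ContinuousLinearMap.snd ℝ ℝ ℝ + (-1 : ℝ) • ContinuousLinearMap.fst ℝ ℝ ℝ)) (t, x) := by
    rw [hfun]
    exact hp
  rw [hp'.fderiv]
  simp only [sub_apply, smul_apply, add_apply, ContinuousLinearMap.coe_snd',
    ContinuousLinearMap.coe_fst', smul_eq_mul, one_mul, neg_one_mul]
  ring_nf

/-- The one-sided Duhamel integrals `A± (t, x) = ∫ s in 0..t, F (s, x + c (t − s))` are `C^n`. -/
theorem contDiff_duhamel_side_nat (n : ℕ) (hF : ContDiff ℝ n F) (c : ℝ) {A : ℝ × ℝ → ℝ}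
    (hA : ∀ t x, A (t, x) = ∫ s in (0 : ℝ)..t, F (s, x + c * (t - s))) : ContDiff ℝ n A := by
  have hJ : ContDiff ℝ n fun r : ℝ × (ℝ × ℝ) => F (r.1, r.2.2 + c * (r.2.1 - r.1)) := by
    refine hF.comp ?_
    fun_prop
  have heq : A = fun p : ℝ × ℝ => ∫ s in (0 : ℝ)..p.1,
      (fun r : ℝ × (ℝ × ℝ) => F (r.1, r.2.2 + c * (r.2.1 - r.1))) (s, p) := by
    funext p
    rw [show p = (p.1, p.2) from rfl, hA]
  rw [heq]
  exact contDiff_leibniz_nat n hJ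

/-- Derivatives of the one-sided Duhamel integrals (`F ∈ C¹`):
`∂A±(t,x)(v) = v₁ F (t, x) + (v₂ + c v₁) ∫ s in 0..t, ∂₂F (s, x + c (t−s))`. -/
theorem fderiv_duhamel_side' (hF : ContDiff ℝ 1 F) (c : ℝ) {A : ℝ × ℝ → ℝ}
    (hA : ∀ t x, A (t, x) = ∫ s in (0 : ℝ)..t, F (s, x + c * (t - s))) (t x : ℝ) (v : ℝ × ℝ) :
    fderiv ℝ A (t, x) v = v.1 * F (t, x)
      + (v.2 + c * v.1) * ∫ s in (0 : ℝ)..t, fderiv ℝ F (s, x + c * (t - s)) (0, 1) := by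
  set J : ℝ × (ℝ × ℝ) → ℝ := fun r => F (r.1, r.2.2 + c * (r.2.1 - r.1)) with hJdef
  have hJ : ContDiff ℝ 1 J := by
    refine hF.comp ?_
    fun_prop
  have heq : A = fun p : ℝ × ℝ => ∫ s in (0 : ℝ)..p.1, J (s, p) := by
    funext p
    rw [show p = (p.1, p.2) from rfl, hA]
  rw [heq, fderiv_leibniz_of_contDiff_one hJ (t, x) v]
  have hJt : J (t, (t, x)) = F (t, x) := by simp [hJdef]
  rw [show ((t, x) : ℝ × ℝ).1 = t from rfl, hJt]
  congr 1
  rw [mul_comm, ← intervalIntegral.integral_mul_const]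
  refine intervalIntegral.integral_congr fun s _ => ?_
  have hslice : fderiv ℝ J (s, (t, x)) ((0 : ℝ), v) = fderiv ℝ (fun p : ℝ × ℝ => J (s, p)) (t, x) v := by
    rw [(hasFDerivAt_slice_snd' (hJ.differentiable (by simp)) s (t, x)).fderiv]
    rfl
  rw [hslice]
  have hp : HasFDerivAt (fun p : ℝ × ℝ => J (s, p))
      (fderiv ℝ F (s, (t, x).2 + c * ((t, x).1 - s)) (0, 1)
        • (ContinuousLinearMap.snd ℝ ℝ ℝ + c • ContinuousLinearMap.fst ℝ ℝ ℝ)) (t, x) :=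
    hasFDerivAt_comp_affine (hF.differentiable (by simp)) s c (t, x)
  rw [hp.fderiv]
  simp only [smul_apply, add_apply, ContinuousLinearMap.coe_snd', ContinuousLinearMap.coe_fst',
    smul_eq_mul]

/-- **The Duhamel operator gains one derivative: `F ∈ C¹ ⇒ D F ∈ C²`.**  The derivative of `D` is
the `C¹` field `z ↦ ½ ((A₊ + A₋)(z) • fst + (A₊ − A₋)(z) • snd)`. [folklore] -/
theorem contDiff_two_duhamel (hF : ContDiff ℝ 1 F) (hΦ : ∀ s z, Φ (s, z) = ∫ y in (0 : ℝ)..z, F (s, y))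
    (hD : ∀ t x, D (t, x) = (1 / 2) * ∫ s in (0 : ℝ)..t, (Φ (s, x + (t - s)) - Φ (s, x - (t - s)))) :
    ContDiff ℝ 2 D := by
  have hD1 := contDiff_duhamel_nat 1 hF hΦ hD
  set A : ℝ × ℝ → ℝ := fun p => ∫ s in (0 : ℝ)..p.1, F (s, p.2 + 1 * (p.1 - s)) with hAdef
  set B : ℝ × ℝ → ℝ := fun p => ∫ s in (0 : ℝ)..p.1, F (s, p.2 + (-1) * (p.1 - s)) with hBdef
  have hAs : ContDiff ℝ 1 A := contDiff_duhamel_side_nat 1 hF 1 (fun _ _ => rfl)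
  have hBs : ContDiff ℝ 1 B := contDiff_duhamel_side_nat 1 hF (-1) (fun _ _ => rfl)
  have hFc : Continuous F := hF.continuous
  have hi : ∀ (c t' x' : ℝ), IntervalIntegrable (fun s => F (s, x' + c * (t' - s))) volume 0 t' :=
    fun c t' x' => (Continuous.intervalIntegrable (by fun_prop) _ _)
  have hfd : fderiv ℝ D = fun z => (1 / 2 : ℝ) • ((A z + B z) • ContinuousLinearMap.fst ℝ ℝ ℝ
      + (A z - B z) • ContinuousLinearMap.snd ℝ ℝ ℝ) := by
    funext z
    obtain ⟨t, x⟩ := z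
    refine ContinuousLinearMap.ext fun v => ?_
    rw [fderiv_duhamel' hF hΦ hD t x v]
    simp only [hAdef, hBdef, smul_apply, add_apply, ContinuousLinearMap.coe_fst',
      ContinuousLinearMap.coe_snd', smul_eq_mul, one_mul, neg_one_mul, ← sub_eq_add_neg]
    have i1 : IntervalIntegrable (fun s => F (s, x + (t - s)) * (v.1 + v.2)) volume 0 t :=
      Continuous.intervalIntegrable (by fun_prop) _ _
    have i2 : IntervalIntegrable (fun s => F (s, x - (t - s)) * (v.1 - v.2)) volume 0 t :=
      Continuous.intervalIntegrable (by fun_prop) _ _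
    rw [intervalIntegral.integral_add i1 i2, intervalIntegral.integral_mul_const,
      intervalIntegral.integral_mul_const]
    ring
  have hC1 : ContDiff ℝ 1 (fderiv ℝ D) := by
    rw [hfd]
    exact (((hAs.add hBs).smul contDiff_const).add ((hAs.sub hBs).smul contDiff_const)).const_smul _
  have h2 : ContDiff ℝ ((1 : ℕ∞ω) + 1) D := by
    rw [contDiff_succ_iff_fderiv]
    exact ⟨hD1.differentiable (by simp), fun h => absurd h (by norm_cast), hC1⟩
  exact h2

end DuhamelFinite

section DuhamelFinite2

variable {F Φ D : ℝ × ℝ → ℝ}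

/-- **Second derivatives of the Duhamel operator** (`F ∈ C¹`): with
`I± = ∫ s in 0..t, ∂₂F (s, x ± (t−s))`,
`∂²D(t,x)(v)(w) = v₁ w₁ F(t,x) + ½ ((v₁+v₂)(w₁+w₂) I₊ + (v₂−v₁)(w₁−w₂) I₋)`. [folklore] -/
theorem fderiv_fderiv_duhamel' (hF : ContDiff ℝ 1 F)
    (hΦ : ∀ s z, Φ (s, z) = ∫ y in (0 : ℝ)..z, F (s, y))
    (hD : ∀ t x, D (t, x) = (1 / 2) * ∫ s in (0 : ℝ)..t, (Φ (s, x + (t - s)) - Φ (s, x - (t - s))))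
    (t x : ℝ) (v w : ℝ × ℝ) :
    fderiv ℝ (fderiv ℝ D) (t, x) v w = v.1 * w.1 * F (t, x) + (1 / 2) *
      ((v.1 + v.2) * (w.1 + w.2) * (∫ s in (0 : ℝ)..t, fderiv ℝ F (s, x + 1 * (t - s)) (0, 1))
        + (v.2 - v.1) * (w.1 - w.2) * (∫ s in (0 : ℝ)..t, fderiv ℝ F (s, x + (-1) * (t - s)) (0, 1))) := by
  have hD2 : ContDiff ℝ 2 D := contDiff_two_duhamel hF hΦ hD
  have hFc' : Continuous F := hF.continuous
  set A : ℝ × ℝ → ℝ := fun p => ∫ s in (0 : ℝ)..p.1, F (s, p.2 + 1 * (p.1 - s)) with hAdef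
  set B : ℝ × ℝ → ℝ := fun p => ∫ s in (0 : ℝ)..p.1, F (s, p.2 + (-1) * (p.1 - s)) with hBdef
  have hA : ∀ t x, A (t, x) = ∫ s in (0 : ℝ)..t, F (s, x + 1 * (t - s)) := fun _ _ => rfl
  have hB : ∀ t x, B (t, x) = ∫ s in (0 : ℝ)..t, F (s, x + (-1) * (t - s)) := fun _ _ => rfl
  have hAd := (contDiff_duhamel_side_nat 1 hF 1 hA).differentiable (by simp)
  have hBd := (contDiff_duhamel_side_nat 1 hF (-1) hB).differentiable (by simp)
  -- the `w`-directional derivative of `D` as a function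
  have hDw : (fun z => fderiv ℝ D z w) = fun z => (1 / 2 : ℝ) * ((A z + B z) * w.1 + (A z - B z) * w.2) := by
    funext z
    obtain ⟨t', x'⟩ := z
    rw [fderiv_duhamel' hF hΦ hD t' x' w, hAdef, hBdef]
    simp only [one_mul, neg_one_mul, ← sub_eq_add_neg]
    have i1 : IntervalIntegrable (fun s => F (s, x' + (t' - s)) * (w.1 + w.2)) volume 0 t' :=
      Continuous.intervalIntegrable (by fun_prop) _ _
    have i2 : IntervalIntegrable (fun s => F (s, x' - (t' - s)) * (w.1 - w.2)) volume 0 t' :=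
      Continuous.intervalIntegrable (by fun_prop) _ _
    rw [intervalIntegral.integral_add i1 i2, intervalIntegral.integral_mul_const,
      intervalIntegral.integral_mul_const]
    ring
  rw [← fderiv_fderiv_apply hD2 (t, x) w v, hDw]
  have hsum : DifferentiableAt ℝ (fun z => A z + B z) (t, x) := (hAd (t, x)).add (hBd (t, x))
  have hdif : DifferentiableAt ℝ (fun z => A z - B z) (t, x) := (hAd (t, x)).sub (hBd (t, x))
  have h1 : DifferentiableAt ℝ (fun z => (A z + B z) * w.1) (t, x) := hsum.mul_const _
  have h2 : DifferentiableAt ℝ (fun z => (A z - B z) * w.2) (t, x) := hdif.mul_const _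
  have hlin : DifferentiableAt ℝ (fun z => (A z + B z) * w.1 + (A z - B z) * w.2) (t, x) := h1.add h2
  rw [fderiv_const_mul hlin]
  simp only [smul_apply, smul_eq_mul]
  rw [fderiv_fun_add h1 h2, fderiv_mul_const hsum, fderiv_mul_const hdif,
    fderiv_fun_add (hAd _) (hBd _), fderiv_fun_sub (hAd _) (hBd _)]
  simp only [add_apply, sub_apply, smul_apply, smul_eq_mul]
  rw [fderiv_duhamel_side' hF 1 hA t x v, fderiv_duhamel_side' hF (-1) hB t x v]
  ring

/-- **The Duhamel operator solves the inhomogeneous wave equation** (`F ∈ C¹`):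
`∂²D(z)(1,0)(1,0) − ∂²D(z)(0,1)(0,1) = F z` for all `z`. [folklore] -/
theorem duhamel_wave_eq' (hF : ContDiff ℝ 1 F) (hΦ : ∀ s z, Φ (s, z) = ∫ y in (0 : ℝ)..z, F (s, y))
    (hD : ∀ t x, D (t, x) = (1 / 2) * ∫ s in (0 : ℝ)..t, (Φ (s, x + (t - s)) - Φ (s, x - (t - s))))
    (z : ℝ × ℝ) :
    fderiv ℝ (fderiv ℝ D) z (1, 0) (1, 0) - fderiv ℝ (fderiv ℝ D) z (0, 1) (0, 1) = F z := by
  obtain ⟨t, x⟩ := z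
  rw [fderiv_fderiv_duhamel' hF hΦ hD t x (1, 0) (1, 0), fderiv_fderiv_duhamel' hF hΦ hD t x (0, 1) (0, 1)]
  ring

/-- Initial data of the Duhamel operator: `D_t (0, x) = 0` (indeed all first partials vanish at
`t = 0`). -/
theorem fderiv_duhamel_zero' (hF : ContDiff ℝ 1 F)
    (hΦ : ∀ s z, Φ (s, z) = ∫ y in (0 : ℝ)..z, F (s, y))
    (hD : ∀ t x, D (t, x) = (1 / 2) * ∫ s in (0 : ℝ)..t, (Φ (s, x + (t - s)) - Φ (s, x - (t - s))))
    (x : ℝ) (v : ℝ × ℝ) : fderiv ℝ D (0, x) v = 0 := by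
  rw [fderiv_duhamel' hF hΦ hD 0 x v]
  simp

end DuhamelFinite2

end WaveEnergy

end

end Summit.FinalStateConjecture.FinalStateConjecture.Theorems
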